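import Literature.Probability.LatticeModels.BoxDirichlet
import HarnessLib

/-!
# Exit of a lattice rectangle through the middle of one side: an explicit lower bound

Topic `Literature/Probability/LatticeModels` (discrete potential theory on `ℤ²`, continuing
`BoxDirichlet.lean`); an instalment (item P5, first step, of the road recorded in
`Sweep1Proofs.lean`, module docstring §2b) of the discharge programme for crit-ising.S18 /
Smirnov's Theorem 2.2. The weak Beurling estimate (Smirnov 2010, Lemma B.2 = "Lemma 7.2" of the
arXiv version, attributed to Kesten) will be proved by chaining elementary "the random walk
started in the middle of a rectangle exits through the middle of a prescribed side with
probability at least `c`" bounds. This file proves that one-step bound in analytic form (no random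
walks): if `u` is lattice-harmonic on an open lattice rectangle, nonnegative on its frame and at
least `m` on the middle half of one side, then `u ≥ m · c` on the transverse middle third at a
definite depth, with the explicit `c = exitConst` depending only on the shape
(`exit_top/bottom/left/right`). The subsolution is the separable harmonic function
`(sin(πξ) sinh(μ₁ y)/sinh(μ₁ H) - sin(3πξ) sinh(μ₃ y)/sinh(μ₃ H))/2`, whose top values
`-cos(2πξ) sin(πξ)` are dominated by the indicator of the middle half. Everything is proved and
`[folklore]`.

* `rectMode`, `latticeLaplacian_rectMode`, side values; `exitSub`, `latticeLaplacian_exitSub`,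
  `exitSub_eq_zero_of_side`, `sin_sub_sin_three_mul`, `exitSub_top_le`;
  `exitConst`, `exitConst_pos`, `exitConst_le_exitSub` (uses `modeRateConst · θ ≤ μ(θ) ≤ θ`).
* `rectInterior`, `rectInterior_finite`, `frame_of_mem_latticeOuterBoundary`, `OnFrame`;
  **`exit_top_lower_bound`**, `exit_top`, `IsLatticeHarmonicOn.comp_motion`, `exit_bottom`,
  `exit_left`, `exit_right` (the other orientations by lattice motions).

## References

* S. Smirnov, Ann. of Math. 172 (2010) 1435–1467, App. B (Lemma B.2) — bib key `Smirnov2010`.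
* H. Kesten, Hitting probabilities of random walks on `ℤ^d`, Stoch. Proc. Appl. 25 (1987) 165–184.
-/

noncomputable section

namespace Literature.Probability.LatticeModels

open Real Finset Set

/-! ### Separable harmonic functions on a rectangle -/

/-- The `k`-th separable lattice-harmonic function of the rectangle `[0, N₁] × [0, N₂]`:
`sin(π k x₀/N₁) · sinh(μ_k x₁)/sinh(μ_k N₂)`, `cosh μ_k = 2 - cos(π k/N₁)`. [folklore] -/
def rectMode (N₁ N₂ k : ℕ) (x : Site 2) : ℝ :=
  sin (boxFreq N₁ k * x 0) * (sinh (modeRate (boxFreq N₁ k) * x 1) / sinh (modeRate (boxFreq N₁ k) * N₂))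

/-- `rectMode` is lattice-harmonic everywhere. [folklore] -/
theorem latticeLaplacian_rectMode (N₁ N₂ k : ℕ) (x : Site 2) : latticeLaplacian (rectMode N₁ N₂ k) x = 0 := by
  unfold rectMode
  have := latticeLaplacian_mul_eq_zero (a := fun i : ℤ => sin (boxFreq N₁ k * i))
    (b := fun j : ℤ => sinh (modeRate (boxFreq N₁ k) * j) / sinh (modeRate (boxFreq N₁ k) * N₂))
    (c := 2 * cos (boxFreq N₁ k)) (d := 2 * cosh (modeRate (boxFreq N₁ k)))
    (fun i => sin_recurrence _ i) (fun j => ?_) (two_mul_cos_add_two_mul_cosh_modeRate _) x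
  · exact this
  · rw [← add_div, sinh_recurrence, mul_div_assoc]

/-- `rectMode` vanishes on the left side `x₀ = 0`. [folklore] -/
theorem rectMode_left {N₁ N₂ k : ℕ} {x : Site 2} (hx : x 0 = 0) : rectMode N₁ N₂ k x = 0 := by
  simp [rectMode, hx]

/-- `rectMode` vanishes on the right side `x₀ = N₁`. [folklore] -/
theorem rectMode_right {N₁ N₂ k : ℕ} (hN₁ : 0 < N₁) {x : Site 2} (hx : x 0 = N₁) : rectMode N₁ N₂ k x = 0 := by
  have : sin (boxFreq N₁ k * x 0) = 0 := by
    rw [hx, boxFreq]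
    have hN : (N₁ : ℝ) ≠ 0 := by exact_mod_cast hN₁.ne'
    rw [show π * k / N₁ * ((N₁ : ℤ) : ℝ) = (k : ℕ) * π by push_cast; field_simp]
    exact sin_nat_mul_pi k
  simp [rectMode, this]

/-- `rectMode` vanishes on the bottom side `x₁ = 0`. [folklore] -/
theorem rectMode_bottom {N₁ N₂ k : ℕ} {x : Site 2} (hx : x 1 = 0) : rectMode N₁ N₂ k x = 0 := by
  simp [rectMode, hx]

/-- On the top side `x₁ = N₂`, `rectMode = sin(π k x₀/N₁)` (for `0 < k ≤ N₁`). [folklore] -/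
theorem rectMode_top {N₁ N₂ k : ℕ} (hk : 0 < k) (hkN : k ≤ N₁) (hN₂ : 0 < N₂) {x : Site 2} (hx : x 1 = N₂) :
    rectMode N₁ N₂ k x = sin (boxFreq N₁ k * x 0) := by
  have hμ := modeRate_boxFreq_pos hk hkN
  have hs : sinh (modeRate (boxFreq N₁ k) * N₂) ≠ 0 := by
    apply ne_of_gt; rw [Real.sinh_pos_iff]; positivity
  rw [rectMode, hx, Int.cast_natCast, div_self hs, mul_one]

/-! ### The exit subsolution -/

/-- **The exit subsolution** `W = (rectMode₁ - rectMode₃)/2` of the rectangle `[0, N₁] × [0, N₂]`: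
harmonic, `0` on three sides, on the top side equal to `-cos(2πξ) sin(πξ)` (`ξ = x₀/N₁`), which is
at most the indicator of the middle half `ξ ∈ [1/4, 3/4]`; and bounded below by
`sin(πξ) sinh(μ₁x₁)/(2 sinh(μ₁N₂))` on the middle third `ξ ∈ [1/3, 2/3]`. [folklore] -/
def exitSub (N₁ N₂ : ℕ) (x : Site 2) : ℝ := (rectMode N₁ N₂ 1 x - rectMode N₁ N₂ 3 x) / 2

/-- The exit subsolution is harmonic. [folklore] -/
theorem latticeLaplacian_exitSub (N₁ N₂ : ℕ) (x : Site 2) : latticeLaplacian (exitSub N₁ N₂) x = 0 := by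
  have e : exitSub N₁ N₂ = fun y => (1 / 2 : ℝ) * (rectMode N₁ N₂ 1 y - rectMode N₁ N₂ 3 y) := by
    funext y; simp [exitSub]; ring
  rw [e, latticeLaplacian_const_mul,
    show (fun y => rectMode N₁ N₂ 1 y - rectMode N₁ N₂ 3 y) = rectMode N₁ N₂ 1 - rectMode N₁ N₂ 3 from rfl,
    latticeLaplacian_sub, latticeLaplacian_rectMode, latticeLaplacian_rectMode]
  ring

/-- The exit subsolution vanishes on the left, right and bottom sides. [folklore] -/
theorem exitSub_eq_zero_of_side {N₁ N₂ : ℕ} (hN₁ : 0 < N₁) {x : Site 2}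
    (hx : x 0 = 0 ∨ x 0 = N₁ ∨ x 1 = 0) : exitSub N₁ N₂ x = 0 := by
  rcases hx with h | h | h
  · simp [exitSub, rectMode_left h]
  · simp [exitSub, rectMode_right hN₁ h]
  · simp [exitSub, rectMode_bottom h]

/-- Trigonometry: `(sin θ - sin 3θ)/2 = -cos 2θ sin θ`. [folklore] -/
theorem sin_sub_sin_three_mul (θ : ℝ) : (sin θ - sin (3 * θ)) / 2 = -(cos (2 * θ) * sin θ) := by
  rw [show 3 * θ = 2 * θ + θ by ring, sin_add, cos_two_mul, sin_two_mul]
  have := sin_sq_add_cos_sq θ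
  nlinarith [this]

/-- **Top values of the exit subsolution are at most the indicator of the middle half.**
[folklore] -/
theorem exitSub_top_le {N₁ N₂ : ℕ} (hN₁ : 4 ≤ N₁) (hN₂ : 0 < N₂) {x : Site 2} (hx : x 1 = N₂)
    (h0 : 0 ≤ x 0) (h1 : x 0 ≤ N₁) :
    exitSub N₁ N₂ x ≤ (if (N₁ : ℤ) ≤ 4 * x 0 ∧ 4 * x 0 ≤ 3 * N₁ then 1 else 0) := by
  have hN₁0 : 0 < N₁ := by omega
  rw [exitSub, rectMode_top one_pos (by omega) hN₂ hx, rectMode_top (by norm_num) (by omega) hN₂ hx]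
  have eθ : boxFreq N₁ 3 * x 0 = 3 * (boxFreq N₁ 1 * x 0) := by simp [boxFreq]; ring
  rw [eθ, sin_sub_sin_three_mul]
  set θ := boxFreq N₁ 1 * x 0 with hθ
  have hN : (0 : ℝ) < N₁ := by exact_mod_cast hN₁0
  have hθ0 : 0 ≤ θ := by rw [hθ]; unfold boxFreq; positivity
  have hθπ : θ ≤ π := by
    rw [hθ, boxFreq, Nat.cast_one, mul_one]
    have : ((x 0 : ℤ) : ℝ) ≤ N₁ := by exact_mod_cast h1
    calc π / N₁ * x 0 ≤ π / N₁ * N₁ := by gcongr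
      _ = π := by field_simp
  have hsin : 0 ≤ sin θ := sin_nonneg_of_nonneg_of_le_pi hθ0 hθπ
  split_ifs with hmid
  · -- `|cos 2θ sin θ| ≤ 1`
    nlinarith [abs_cos_le_one (2 * θ), abs_sin_le_one θ, abs_nonneg (cos (2 * θ)), abs_le.1 (abs_cos_le_one (2 * θ)) |>.1,
      neg_abs_le (cos (2 * θ) * sin θ), abs_mul (cos (2 * θ)) (sin θ), sin_le_one θ]
  · -- outside the middle half `cos 2θ ≥ 0`
    rw [not_and_or, not_le, not_le] at hmid
    have hcos : 0 ≤ cos (2 * θ) := by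
      rcases hmid with h | h
      · -- `4 x₀ < N₁`: `2θ ≤ π/2`
        apply cos_nonneg_of_neg_pi_div_two_le_of_le <;> rw [hθ, boxFreq, Nat.cast_one, mul_one]
        · have : (0:ℝ) ≤ π / N₁ * x 0 := by positivity
          linarith [pi_pos]
        · have : (4 * x 0 : ℝ) ≤ N₁ := by exact_mod_cast h.le
          rw [show 2 * (π / ↑N₁ * ↑(x 0)) = π * (4 * (x 0 : ℝ)) / (2 * N₁) by field_simp; ring]
          rw [div_le_div_iff₀ (by positivity) (by norm_num)]
          nlinarith [pi_pos]
      · -- `3 N₁ < 4 x₀`: `2θ ∈ [3π/2, 2π]`, use `cos (2θ) = cos (2π - 2θ)`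
        have h' : (3 * N₁ : ℝ) ≤ 4 * x 0 := by exact_mod_cast h.le
        rw [← Real.cos_two_pi_sub]
        apply cos_nonneg_of_neg_pi_div_two_le_of_le <;> rw [hθ, boxFreq, Nat.cast_one, mul_one]
        · have : ((x 0 : ℤ) : ℝ) ≤ N₁ := by exact_mod_cast h1
          have : π / N₁ * x 0 ≤ π := by
            calc π / N₁ * x 0 ≤ π / N₁ * N₁ := by gcongr
              _ = π := by field_simp
          linarith [pi_pos]
        · rw [show 2 * π - 2 * (π / ↑N₁ * ↑(x 0)) = π * (2 * N₁ - 2 * (x 0 : ℝ)) / N₁ by field_simp]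
          rw [div_le_div_iff₀ (by positivity) (by norm_num)]
          nlinarith [pi_pos]
    nlinarith

/-! ### The lower bound on the middle third -/

/-- The explicit exit constant `c(N₁, N₂, d) = (√3/2) · modeRateConst · (π d/N₁) · e^{-π N₂/N₁}`.
[folklore] -/
def exitConst (N₁ N₂ d : ℕ) : ℝ := Real.sqrt 3 / 2 * modeRateConst * (π * d / N₁) * exp (-(π * N₂ / N₁))

/-- The exit constant is positive (for `d, N₁ > 0`). [folklore] -/
theorem exitConst_pos {N₁ N₂ d : ℕ} (hN₁ : 0 < N₁) (hd : 0 < d) : 0 < exitConst N₁ N₂ d := by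
  unfold exitConst
  have := modeRateConst_pos
  have : (0 : ℝ) < Real.sqrt 3 := Real.sqrt_pos.2 (by norm_num)
  positivity

/-- `sinh y ≤ e^y / 2`. [folklore] -/
theorem sinh_le_exp_div_two (y : ℝ) : sinh y ≤ exp y / 2 := by
  rw [Real.sinh_eq]; linarith [exp_pos (-y)]

/-- `sin ≥ √3/2` on `[π/3, 2π/3]`. [folklore] -/
theorem sqrt_three_div_two_le_sin {t : ℝ} (h1 : π / 3 ≤ t) (h2 : t ≤ 2 * π / 3) : Real.sqrt 3 / 2 ≤ sin t := by
  rcases le_total t (π / 2) with h | h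
  · rw [← Real.sin_pi_div_three]
    exact Real.sin_le_sin_of_le_of_le_pi_div_two (by linarith [pi_pos]) h h1
  · rw [← Real.sin_pi_div_three, ← Real.sin_pi_sub t]
    exact Real.sin_le_sin_of_le_of_le_pi_div_two (by linarith [pi_pos]) (by linarith) (by linarith)

/-- **Lower bound for the exit subsolution on the middle third**: for `N₁ ≤ 3x₀ ≤ 2N₁` and
`d ≤ x₁ ≤ N₂`, `exitSub N₁ N₂ x ≥ exitConst N₁ N₂ d`. [folklore] -/
theorem exitConst_le_exitSub {N₁ N₂ d : ℕ} (hN₁ : 3 ≤ N₁) (hN₂ : 0 < N₂) {x : Site 2}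
    (h3 : (N₁ : ℤ) ≤ 3 * x 0) (h3' : 3 * x 0 ≤ 2 * N₁) (hd : (d : ℤ) ≤ x 1) (hx1 : x 1 ≤ N₂) :
    exitConst N₁ N₂ d ≤ exitSub N₁ N₂ x := by
  have hN : (0 : ℝ) < N₁ := by exact_mod_cast (show 0 < N₁ by omega)
  have hx0 : (N₁ : ℝ) ≤ 3 * x 0 := by exact_mod_cast h3
  have hx0' : 3 * (x 0 : ℝ) ≤ 2 * N₁ := by exact_mod_cast h3'
  have hdx : (d : ℝ) ≤ x 1 := by exact_mod_cast hd
  have hx1N : ((x 1 : ℤ) : ℝ) ≤ N₂ := by exact_mod_cast hx1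
  have hd0 : (0 : ℝ) ≤ d := Nat.cast_nonneg d
  set θ := boxFreq N₁ 1 with hθ
  have hθ' : θ = π / N₁ := by rw [hθ, boxFreq, Nat.cast_one, mul_one]
  set μ₁ := modeRate (boxFreq N₁ 1) with hμ₁
  set μ₃ := modeRate (boxFreq N₁ 3) with hμ₃
  have hμ₁0 : 0 < μ₁ := modeRate_boxFreq_pos one_pos (by omega)
  have hμ₃0 : 0 ≤ μ₃ := modeRate_nonneg _
  -- `sin(3θx₀) ≤ 0` since `3θx₀ ∈ [π, 2π]`
  have hsin3 : sin (boxFreq N₁ 3 * x 0) ≤ 0 := by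
    have e : boxFreq N₁ 3 * x 0 = π * (3 * (x 0 : ℝ)) / N₁ := by simp [boxFreq]; ring
    rw [e, ← Real.sin_sub_two_pi]
    apply sin_nonpos_of_nonpos_of_neg_pi_le
    · rw [sub_nonpos, div_le_iff₀ hN]; nlinarith [pi_pos]
    · rw [le_sub_iff_add_le, le_div_iff₀ hN]; nlinarith [pi_pos]
  -- `sin(θx₀) ≥ √3/2` since `θx₀ ∈ [π/3, 2π/3]`
  have hsin1 : Real.sqrt 3 / 2 ≤ sin (θ * x 0) := by
    rw [hθ']
    apply sqrt_three_div_two_le_sin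
    · rw [div_mul_eq_mul_div, le_div_iff₀ hN]; nlinarith [pi_pos]
    · rw [div_mul_eq_mul_div, div_le_iff₀ hN]; nlinarith [pi_pos]
  -- the sinh ratios
  have hr3 : 0 ≤ sinh (μ₃ * x 1) / sinh (μ₃ * N₂) := by
    apply div_nonneg
    · rw [Real.sinh_nonneg_iff]; exact mul_nonneg hμ₃0 (by linarith)
    · rw [Real.sinh_nonneg_iff]; positivity
  have hsN : 0 < sinh (μ₁ * N₂) := by
    rw [Real.sinh_pos_iff]; exact mul_pos hμ₁0 (by exact_mod_cast hN₂)
  have hbf : boxFreq N₁ 1 = π / N₁ := by rw [boxFreq, Nat.cast_one, mul_one]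
  have hr1 : 2 * (modeRateConst * (π / N₁) * d) * exp (-(π * N₂ / N₁)) ≤ sinh (μ₁ * x 1) / sinh (μ₁ * N₂) := by
    -- `sinh(μ₁ d) ≥ μ₁ d ≥ modeRateConst (π/N₁) d` and `sinh(μ₁ N₂) ≤ e^{μ₁N₂}/2 ≤ e^{πN₂/N₁}/2`
    have hμlow : modeRateConst * (π / N₁) ≤ μ₁ := by
      rw [← hbf]
      have := modeRateConst_mul_le (θ := boxFreq N₁ 1) (by
        rw [abs_of_nonneg (boxFreq_nonneg _ _)]; exact boxFreq_le_pi (by omega))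
      rwa [abs_of_nonneg (boxFreq_nonneg _ _)] at this
    have hμup : μ₁ ≤ π / N₁ := by
      rw [← hbf]
      have := modeRate_le_abs (boxFreq N₁ 1)
      rwa [abs_of_nonneg (boxFreq_nonneg _ _)] at this
    have hnum : modeRateConst * (π / N₁) * d ≤ sinh (μ₁ * x 1) := by
      calc modeRateConst * (π / N₁) * d ≤ μ₁ * d := by gcongr
        _ ≤ μ₁ * x 1 := by gcongr
        _ ≤ sinh (μ₁ * x 1) := Real.self_le_sinh_iff.2 (mul_nonneg hμ₁0.le (by linarith))
    have hden : sinh (μ₁ * N₂) ≤ exp (π * N₂ / N₁) / 2 := by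
      calc sinh (μ₁ * N₂) ≤ exp (μ₁ * N₂) / 2 := sinh_le_exp_div_two _
        _ ≤ exp (π * N₂ / N₁) / 2 := by
            gcongr
            calc μ₁ * N₂ ≤ π / N₁ * N₂ := by gcongr
              _ = π * N₂ / N₁ := by ring
    rw [le_div_iff₀ hsN]
    have hmc := modeRateConst_pos
    calc 2 * (modeRateConst * (π / ↑N₁) * ↑d) * exp (-(π * ↑N₂ / ↑N₁)) * sinh (μ₁ * ↑N₂)
        ≤ 2 * (modeRateConst * (π / ↑N₁) * ↑d) * exp (-(π * ↑N₂ / ↑N₁)) * (exp (π * N₂ / N₁) / 2) := by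
          gcongr
      _ = modeRateConst * (π / ↑N₁) * ↑d := by rw [Real.exp_neg]; field_simp
      _ ≤ sinh (μ₁ * x 1) := hnum
  -- assemble
  have hmain : exitSub N₁ N₂ x = (sin (θ * x 0) * (sinh (μ₁ * x 1) / sinh (μ₁ * N₂)) -
      sin (boxFreq N₁ 3 * x 0) * (sinh (μ₃ * x 1) / sinh (μ₃ * N₂))) / 2 := rfl
  rw [hmain]
  have hneg : 0 ≤ -(sin (boxFreq N₁ 3 * x 0) * (sinh (μ₃ * x 1) / sinh (μ₃ * N₂))) := by
    rw [neg_mul_eq_neg_mul]; exact mul_nonneg (by linarith) hr3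
  have hs1 : 0 ≤ sin (θ * x 0) := le_trans (by positivity) hsin1
  have hprod : Real.sqrt 3 / 2 * (2 * (modeRateConst * (π / N₁) * d) * exp (-(π * N₂ / N₁))) ≤
      sin (θ * x 0) * (sinh (μ₁ * x 1) / sinh (μ₁ * N₂)) :=
    mul_le_mul hsin1 hr1 (by have := modeRateConst_pos; positivity) hs1
  calc exitConst N₁ N₂ d = Real.sqrt 3 / 2 * (2 * (modeRateConst * (π / N₁) * d) * exp (-(π * N₂ / N₁))) / 2 := by
        unfold exitConst; ring
    _ ≤ sin (θ * x 0) * (sinh (μ₁ * x 1) / sinh (μ₁ * N₂)) / 2 := by linarith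
    _ ≤ _ := by linarith

/-! ### Rectangles and their frames -/

/-- The open lattice rectangle `(a₀, a₀ + N₁) × (a₁, a₁ + N₂)`. [folklore] -/
def rectInterior (a : Site 2) (N₁ N₂ : ℕ) : Set (Site 2) :=
  {x | a 0 < x 0 ∧ x 0 < a 0 + N₁ ∧ a 1 < x 1 ∧ x 1 < a 1 + N₂}

/-- The open rectangle is finite. [folklore] -/
theorem rectInterior_finite (a : Site 2) (N₁ N₂ : ℕ) : (rectInterior a N₁ N₂).Finite := by
  have h : rectInterior a N₁ N₂ ⊆ (fun p : ℤ × ℤ => (![p.1, p.2] : Site 2)) ''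
      (Set.Icc (a 0) (a 0 + N₁) ×ˢ Set.Icc (a 1) (a 1 + N₂)) := by
    intro x hx
    refine ⟨(x 0, x 1), ⟨⟨hx.1.le, hx.2.1.le⟩, ⟨hx.2.2.1.le, hx.2.2.2.le⟩⟩, ?_⟩
    ext i; fin_cases i <;> rfl
  exact ((Set.finite_Icc _ _).prod (Set.finite_Icc _ _)).image _ |>.subset h

/-- Points of the outer boundary of the open rectangle lie on its frame. [folklore] -/
theorem frame_of_mem_latticeOuterBoundary {a : Site 2} {N₁ N₂ : ℕ} {w : Site 2}
    (hw : w ∈ latticeOuterBoundary (rectInterior a N₁ N₂)) :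
    ((w 0 = a 0 ∨ w 0 = a 0 + N₁) ∧ a 1 < w 1 ∧ w 1 < a 1 + N₂) ∨
      ((w 1 = a 1 ∨ w 1 = a 1 + N₂) ∧ a 0 < w 0 ∧ w 0 < a 0 + N₁) := by
  obtain ⟨hwR, v, hv, k, rfl⟩ := hw
  simp only [rectInterior, Set.mem_setOf_eq, not_and, not_lt] at hwR hv
  obtain ⟨h1, h2, h3, h4⟩ := hv
  fin_cases k <;> simp [cornerUnit] at hwR ⊢ <;> omega

/-! ### The one-step exit lemma (top side) -/

/-- **One-step exit lower bound (top side).** Let `u` be lattice-harmonic on the open rectangle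
`(a₀, a₀+N₁) × (a₁, a₁+N₂)`, nonnegative on its frame and at least `m ≥ 0` on the middle half of
the top side. Then on the middle third (in `x₀`) at height `x₁ - a₁ ≥ d`, `u ≥ m · exitConst`
(minimum principle applied to `u - m · exitSub (· - a)`). [folklore] -/
theorem exit_top_lower_bound (a : Site 2) {N₁ N₂ : ℕ} (hN₁ : 4 ≤ N₁) (hN₂ : 0 < N₂) {u : Site 2 → ℝ}
    (hu : IsLatticeHarmonicOn u (rectInterior a N₁ N₂))
    (hframe : ∀ w ∈ latticeOuterBoundary (rectInterior a N₁ N₂), 0 ≤ u w)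
    {m : ℝ} (hm : 0 ≤ m)
    (htop : ∀ w : Site 2, w 1 = a 1 + N₂ → (N₁ : ℤ) ≤ 4 * (w 0 - a 0) → 4 * (w 0 - a 0) ≤ 3 * N₁ → m ≤ u w)
    {x : Site 2} (hx : x ∈ rectInterior a N₁ N₂) (h3 : (N₁ : ℤ) ≤ 3 * (x 0 - a 0)) (h3' : 3 * (x 0 - a 0) ≤ 2 * N₁)
    {d : ℕ} (hd : (d : ℤ) ≤ x 1 - a 1) :
    m * exitConst N₁ N₂ d ≤ u x := by
  -- the shifted subsolution
  set W : Site 2 → ℝ := fun y => exitSub N₁ N₂ (y - a) with hW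
  have hWharm : ∀ y, latticeLaplacian W y = 0 := by
    intro y
    have hσ : IsLatticeMotion (fun y : Site 2 => y - a) := ⟨Equiv.refl _, fun y k => by simp [sub_add_eq_add_sub]⟩
    rw [hW, hσ.latticeLaplacian_comp (exitSub N₁ N₂) y, latticeLaplacian_exitSub]
  -- `u - m W` is harmonic on the rectangle and `≥ 0` on the frame
  have hsuper : IsLatticeSuperharmonicOn (fun y => u y - m * W y) (rectInterior a N₁ N₂) := by
    intro y hy
    rw [show (fun y => u y - m * W y) = u - (fun y => m * W y) from rfl, latticeLaplacian_sub,
      show (fun y => m * W y) = fun y => m * W y from rfl, latticeLaplacian_const_mul, hWharm, hu y hy]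
    simp
  have hbd : ∀ w ∈ latticeOuterBoundary (rectInterior a N₁ N₂), 0 ≤ u w - m * W w := by
    intro w hw
    have hf := frame_of_mem_latticeOuterBoundary hw
    have hN₁0 : 0 < N₁ := by omega
    rcases hf with ⟨h0 | h0, h1, h2⟩ | ⟨h0 | h0, h1, h2⟩
    · -- left side
      have : W w = 0 := exitSub_eq_zero_of_side hN₁0 (Or.inl (by simp only [Pi.sub_apply]; omega))
      rw [this, mul_zero, sub_zero]; exact hframe w hw
    · -- right side
      have : W w = 0 := exitSub_eq_zero_of_side hN₁0 (Or.inr (Or.inl (by simp only [Pi.sub_apply]; omega)))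
      rw [this, mul_zero, sub_zero]; exact hframe w hw
    · -- bottom side
      have : W w = 0 := exitSub_eq_zero_of_side hN₁0 (Or.inr (Or.inr (by simp only [Pi.sub_apply]; omega)))
      rw [this, mul_zero, sub_zero]; exact hframe w hw
    · -- top side: `W ≤ 1_{middle half}`
      have htop' := exitSub_top_le (N₁ := N₁) (N₂ := N₂) hN₁ hN₂ (x := w - a)
        (by simp only [Pi.sub_apply]; omega) (by simp only [Pi.sub_apply]; omega) (by simp only [Pi.sub_apply]; omega)
      simp only [Pi.sub_apply] at htop'
      split_ifs at htop' with hmid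
      · have := htop w h0 hmid.1 hmid.2
        have hWle : m * W w ≤ m * 1 := mul_le_mul_of_nonneg_left htop' hm
        linarith
      · have hWle : m * W w ≤ m * 0 := mul_le_mul_of_nonneg_left htop' hm
        linarith [hframe w hw]
  have key := hsuper.ge_of_forall_boundary_ge (rectInterior_finite a N₁ N₂) (M := 0) hbd x hx
  -- `W x ≥ exitConst`
  have hWx : exitConst N₁ N₂ d ≤ W x := by
    have hx4 := hx.2.2.2
    exact exitConst_le_exitSub (by omega) hN₂ (by simp only [Pi.sub_apply]; exact h3)
      (by simp only [Pi.sub_apply]; exact h3') (by simp only [Pi.sub_apply]; exact hd) (by simp only [Pi.sub_apply]; omega)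
  have := mul_le_mul_of_nonneg_left hWx hm
  linarith

/-! ### The frame of a rectangle and the four orientations -/

/-- The frame (four open sides) of the rectangle `[a₀, a₀+N₁] × [a₁, a₁+N₂]`. [folklore] -/
def OnFrame (a : Site 2) (N₁ N₂ : ℕ) (w : Site 2) : Prop :=
  ((w 0 = a 0 ∨ w 0 = a 0 + N₁) ∧ a 1 < w 1 ∧ w 1 < a 1 + N₂) ∨
    ((w 1 = a 1 ∨ w 1 = a 1 + N₂) ∧ a 0 < w 0 ∧ w 0 < a 0 + N₁)

/-- **One-step exit lower bound, top side, frame form.** [folklore] -/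
theorem exit_top (a : Site 2) {N₁ N₂ : ℕ} (hN₁ : 4 ≤ N₁) (hN₂ : 0 < N₂) {u : Site 2 → ℝ}
    (hu : IsLatticeHarmonicOn u (rectInterior a N₁ N₂))
    (hframe : ∀ w, OnFrame a N₁ N₂ w → 0 ≤ u w) {m : ℝ} (hm : 0 ≤ m)
    (hexit : ∀ w : Site 2, w 1 = a 1 + N₂ → (N₁ : ℤ) ≤ 4 * (w 0 - a 0) → 4 * (w 0 - a 0) ≤ 3 * N₁ → m ≤ u w)
    {x : Site 2} (hx : x ∈ rectInterior a N₁ N₂) (h3 : (N₁ : ℤ) ≤ 3 * (x 0 - a 0)) (h3' : 3 * (x 0 - a 0) ≤ 2 * N₁)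
    {d : ℕ} (hd : (d : ℤ) ≤ x 1 - a 1) :
    m * exitConst N₁ N₂ d ≤ u x :=
  exit_top_lower_bound a hN₁ hN₂ hu (fun w hw => hframe w (frame_of_mem_latticeOuterBoundary hw)) hm hexit hx h3 h3' hd

/-- Transport of harmonicity along a lattice motion. [folklore] -/
theorem IsLatticeHarmonicOn.comp_motion {σ : Site 2 → Site 2} (hσ : IsLatticeMotion σ) {u : Site 2 → ℝ}
    {R R₀ : Set (Site 2)} (hu : IsLatticeHarmonicOn u R) (hmap : ∀ y ∈ R₀, σ y ∈ R) :
    IsLatticeHarmonicOn (fun y => u (σ y)) R₀ := fun y hy => by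
  rw [hσ.latticeLaplacian_comp u y]; exact hu _ (hmap y hy)

/-- **One-step exit lower bound, bottom side** `x₁ = a₁`: exit segment the middle half of the
bottom side, start region the middle third in `x₀` at depth `x₁ ≤ a₁ + N₂ - d`. [folklore] -/
theorem exit_bottom (a : Site 2) {N₁ N₂ : ℕ} (hN₁ : 4 ≤ N₁) (hN₂ : 0 < N₂) {u : Site 2 → ℝ}
    (hu : IsLatticeHarmonicOn u (rectInterior a N₁ N₂))
    (hframe : ∀ w, OnFrame a N₁ N₂ w → 0 ≤ u w) {m : ℝ} (hm : 0 ≤ m)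
    (hexit : ∀ w : Site 2, w 1 = a 1 → (N₁ : ℤ) ≤ 4 * (w 0 - a 0) → 4 * (w 0 - a 0) ≤ 3 * N₁ → m ≤ u w)
    {x : Site 2} (hx : x ∈ rectInterior a N₁ N₂) (h3 : (N₁ : ℤ) ≤ 3 * (x 0 - a 0)) (h3' : 3 * (x 0 - a 0) ≤ 2 * N₁)
    {d : ℕ} (hd : (d : ℤ) ≤ a 1 + N₂ - x 1) :
    m * exitConst N₁ N₂ d ≤ u x := by
  set σ : Site 2 → Site 2 := fun y => ![a 0 + y 0, a 1 + N₂ - y 1] with hσdef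
  have hσ : IsLatticeMotion σ := ⟨Equiv.swap 1 3, fun y k => by
    ext i; fin_cases i <;> fin_cases k <;> simp [hσdef, cornerUnit, Equiv.swap_apply_def] <;> ring⟩
  have hu' : IsLatticeHarmonicOn (fun y => u (σ y)) (rectInterior 0 N₁ N₂) :=
    hu.comp_motion hσ fun y hy => by
      simp only [rectInterior, Set.mem_setOf_eq, hσdef] at hy ⊢
      simp only [Matrix.cons_val_zero, Matrix.cons_val_one, Pi.zero_apply] at hy ⊢
      omega
  set y : Site 2 := ![x 0 - a 0, a 1 + N₂ - x 1] with hy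
  have hσy : σ y = x := by ext i; fin_cases i <;> simp [hσdef, hy]
  have key := exit_top 0 hN₁ hN₂ hu' (fun w hw => hframe _ ?_) hm (fun w h1 h2 h3 => hexit _ ?_ ?_ ?_) (x := y) ?_ ?_ ?_ (d := d) ?_
  · rwa [hσy] at key
  · simp only [OnFrame, hσdef, Pi.zero_apply] at hw ⊢
    simp only [Matrix.cons_val_zero, Matrix.cons_val_one]
    omega
  · simp only [hσdef, Matrix.cons_val_one, Pi.zero_apply, zero_add] at h1 ⊢; rw [h1]; push_cast; ring
  · simp only [hσdef, Matrix.cons_val_zero, Pi.zero_apply, sub_zero] at h2 ⊢; linarith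
  · simp only [hσdef, Matrix.cons_val_zero, Pi.zero_apply, sub_zero] at h3 ⊢; linarith
  · simp only [rectInterior, Set.mem_setOf_eq] at hx ⊢
    simp only [hy, Matrix.cons_val_zero, Matrix.cons_val_one, Pi.zero_apply]; omega
  · simp only [hy, Matrix.cons_val_zero, Pi.zero_apply, sub_zero]; exact h3
  · simp only [hy, Matrix.cons_val_zero, Pi.zero_apply, sub_zero]; exact h3'
  · simp only [hy, Matrix.cons_val_one, Pi.zero_apply, sub_zero]; exact hd

/-- **One-step exit lower bound, left side** `x₀ = a₀`: exit segment the middle half (in `x₁`) of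
the left side, start region the middle third in `x₁` at depth `x₀ ≤ a₀ + N₁ - d`; the transverse
length is `N₂`, the depth `N₁`. [folklore] -/
theorem exit_left (a : Site 2) {N₁ N₂ : ℕ} (hN₂ : 4 ≤ N₂) (hN₁ : 0 < N₁) {u : Site 2 → ℝ}
    (hu : IsLatticeHarmonicOn u (rectInterior a N₁ N₂))
    (hframe : ∀ w, OnFrame a N₁ N₂ w → 0 ≤ u w) {m : ℝ} (hm : 0 ≤ m)
    (hexit : ∀ w : Site 2, w 0 = a 0 → (N₂ : ℤ) ≤ 4 * (w 1 - a 1) → 4 * (w 1 - a 1) ≤ 3 * N₂ → m ≤ u w)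
    {x : Site 2} (hx : x ∈ rectInterior a N₁ N₂) (h3 : (N₂ : ℤ) ≤ 3 * (x 1 - a 1)) (h3' : 3 * (x 1 - a 1) ≤ 2 * N₂)
    {d : ℕ} (hd : (d : ℤ) ≤ a 0 + N₁ - x 0) :
    m * exitConst N₂ N₁ d ≤ u x := by
  set σ : Site 2 → Site 2 := fun y => ![a 0 + N₁ - y 1, a 1 + y 0] with hσdef
  have hσ : IsLatticeMotion σ := ⟨Equiv.addRight (1 : Fin 4), fun y k => by
    ext i; fin_cases i <;> fin_cases k <;> simp [hσdef, cornerUnit] <;> ring⟩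
  have hu' : IsLatticeHarmonicOn (fun y => u (σ y)) (rectInterior 0 N₂ N₁) :=
    hu.comp_motion hσ fun y hy => by
      simp only [rectInterior, Set.mem_setOf_eq, hσdef] at hy ⊢
      simp only [Matrix.cons_val_zero, Matrix.cons_val_one, Pi.zero_apply] at hy ⊢
      omega
  set y : Site 2 := ![x 1 - a 1, a 0 + N₁ - x 0] with hy
  have hσy : σ y = x := by ext i; fin_cases i <;> simp [hσdef, hy]
  have key := exit_top 0 hN₂ hN₁ hu' (fun w hw => hframe _ ?_) hm (fun w h1 h2 h3 => hexit _ ?_ ?_ ?_) (x := y) ?_ ?_ ?_ (d := d) ?_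
  · rwa [hσy] at key
  · simp only [OnFrame, hσdef, Pi.zero_apply] at hw ⊢
    simp only [Matrix.cons_val_zero, Matrix.cons_val_one]
    omega
  · simp only [hσdef, Matrix.cons_val_zero, Pi.zero_apply, zero_add] at h1 ⊢; rw [h1]; ring
  · simp only [hσdef, Matrix.cons_val_zero, Matrix.cons_val_one, Pi.zero_apply, sub_zero] at h2 ⊢; linarith
  · simp only [hσdef, Matrix.cons_val_zero, Matrix.cons_val_one, Pi.zero_apply, sub_zero] at h3 ⊢; linarith
  · simp only [rectInterior, Set.mem_setOf_eq] at hx ⊢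
    simp only [hy, Matrix.cons_val_zero, Matrix.cons_val_one, Pi.zero_apply]; omega
  · simp only [hy, Matrix.cons_val_zero, Pi.zero_apply, sub_zero]; exact h3
  · simp only [hy, Matrix.cons_val_zero, Pi.zero_apply, sub_zero]; exact h3'
  · simp only [hy, Matrix.cons_val_one, Pi.zero_apply, sub_zero]; exact hd

/-- **One-step exit lower bound, right side** `x₀ = a₀ + N₁`. [folklore] -/
theorem exit_right (a : Site 2) {N₁ N₂ : ℕ} (hN₂ : 4 ≤ N₂) (hN₁ : 0 < N₁) {u : Site 2 → ℝ}
    (hu : IsLatticeHarmonicOn u (rectInterior a N₁ N₂))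
    (hframe : ∀ w, OnFrame a N₁ N₂ w → 0 ≤ u w) {m : ℝ} (hm : 0 ≤ m)
    (hexit : ∀ w : Site 2, w 0 = a 0 + N₁ → (N₂ : ℤ) ≤ 4 * (w 1 - a 1) → 4 * (w 1 - a 1) ≤ 3 * N₂ → m ≤ u w)
    {x : Site 2} (hx : x ∈ rectInterior a N₁ N₂) (h3 : (N₂ : ℤ) ≤ 3 * (x 1 - a 1)) (h3' : 3 * (x 1 - a 1) ≤ 2 * N₂)
    {d : ℕ} (hd : (d : ℤ) ≤ x 0 - a 0) :
    m * exitConst N₂ N₁ d ≤ u x := by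
  set σ : Site 2 → Site 2 := fun y => ![a 0 + y 1, a 1 + y 0] with hσdef
  have hσ : IsLatticeMotion σ := ⟨(Equiv.swap 0 1).trans (Equiv.swap 2 3), fun y k => by
    ext i; fin_cases i <;> fin_cases k <;> simp [hσdef, cornerUnit, Equiv.swap_apply_def] <;> ring⟩
  have hu' : IsLatticeHarmonicOn (fun y => u (σ y)) (rectInterior 0 N₂ N₁) :=
    hu.comp_motion hσ fun y hy => by
      simp only [rectInterior, Set.mem_setOf_eq, hσdef] at hy ⊢
      simp only [Matrix.cons_val_zero, Matrix.cons_val_one, Pi.zero_apply] at hy ⊢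
      omega
  set y : Site 2 := ![x 1 - a 1, x 0 - a 0] with hy
  have hσy : σ y = x := by ext i; fin_cases i <;> simp [hσdef, hy]
  have key := exit_top 0 hN₂ hN₁ hu' (fun w hw => hframe _ ?_) hm (fun w h1 h2 h3 => hexit _ ?_ ?_ ?_) (x := y) ?_ ?_ ?_ (d := d) ?_
  · rwa [hσy] at key
  · simp only [OnFrame, hσdef, Pi.zero_apply] at hw ⊢
    simp only [Matrix.cons_val_zero, Matrix.cons_val_one]
    omega
  · simp only [hσdef, Matrix.cons_val_zero, Pi.zero_apply, zero_add] at h1 ⊢; rw [h1]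
  · simp only [hσdef, Matrix.cons_val_zero, Matrix.cons_val_one, Pi.zero_apply, sub_zero] at h2 ⊢; linarith
  · simp only [hσdef, Matrix.cons_val_zero, Matrix.cons_val_one, Pi.zero_apply, sub_zero] at h3 ⊢; linarith
  · simp only [rectInterior, Set.mem_setOf_eq] at hx ⊢
    simp only [hy, Matrix.cons_val_zero, Matrix.cons_val_one, Pi.zero_apply]; omega
  · simp only [hy, Matrix.cons_val_zero, Pi.zero_apply, sub_zero]; exact h3
  · simp only [hy, Matrix.cons_val_zero, Pi.zero_apply, sub_zero]; exact h3'
  · simp only [hy, Matrix.cons_val_one, Pi.zero_apply, sub_zero]; exact hd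

end Literature.Probability.LatticeModels
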